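import Mathlib.Analysis.Calculus.MeanValue
import Mathlib.Topology.ContinuousOn
import Literature.Analysis.Calculus.RadiiPolynomial
import HarnessLib

/-!
# Rigorous branch following: solution curves from radii polynomials uniform in a parameter
# (van den Berg–Lessard–Mischaikow 2010), continuity and junction of validated patches

Topic `Literature/Analysis/Calculus`.  `RadiiPolynomial.lean` proves the POINTWISE a-posteriori
validation theorem (`existsUnique_zero_of_newtonLike`: `‖A F(x̄)‖ ≤ Y₀`, `‖I − A∘DF‖ ≤ Z` on `B̄_r(x̄)`,
`Y₀ + Z r < r` ⇒ a unique zero in `B̄_r(x̄)`).  This file **proves** the PARAMETER-DEPENDENT statements by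
which validated continuation certifies a whole BRANCH of zeros `ν ↦ x⋆(ν)` of `f(ν, x) = 0` — "no fold
inside the tube" — from bounds uniform in `ν`, and glues two certified patches at a common parameter
value.  Source: J. B. van den Berg, J.-P. Lessard, K. Mischaikow, *Global smooth solution curves using
rigorous branch following*, Math. Comp. **79** (2010) 1565–1584 [BergLessardMischaikow2010], §2
[corpus:paper:doi-10-1090-s0025-5718-10-02325-2 p.8–10]:

> "**Lemma 7.** Recall (2) and suppose that `F ∈ C^ℓ(ℝ^{l₁} × B₁, ℝ^{l₂} × B₂)`, `ℓ ≥ 1`.  If there exists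
> an `r > 0` and a small `Δ_ν` such that `p_k(r, |Δ_ν|) < 0` for all `k = k₀, …, M`, then there exists a
> `C^ℓ` function `x̃ : [ν₀ − Δ_ν, ν₀ + Δ_ν] → Φ : ν ↦ x̃(ν)` such that `f(ν, x̃(ν)) = 0` for all
> `ν ∈ [ν₀ − Δ_ν, ν₀ + Δ_ν]`.  Furthermore, these are the only solutions of `f(ν, x) = 0` in the tube
> `{|ν − ν₀| ≤ Δ_ν, x − x_ν ∈ B(r)}`."  [`x_ν = x̄ + Δ_ν ẋ` the predictor; proof: "for every fixed `ν`,
> `T_ν : B_{x_ν} → B_{x_ν}` is a contraction … `T : [ν₀ − Δ_ν, ν₀ + Δ_ν] × B(r) → B(r)`,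
> `(ν, y) ↦ T_ν(y + x_ν)` is a uniform contraction on `B(r)` … By the uniform contraction principle … we
> conclude that `x̃(ν)` is a `C^ℓ` function of `ν`."]
>
> "**Proposition 8.** If `B₀ ⊂ B₁⁺` or `B₁⁻ ⊂ B₀`, then `C₀ ∪ C₁` consists of a continuous branch of
> solutions of `f(ν, x) = 0`, and `C₀ ∩ C₁ = {(ν₁, x⁰(ν₁))} = {(ν₁, x¹(ν₁))} ⊆ B₀ ∩ B₁`.  Moreover, if
> `T(ν, x) = T_ν(x)` is of class `C^ℓ`, then `C₀ ∪ C₁` is a `C^ℓ` smooth curve."  [`B₀ = x̄₀ + (ν₁ − ν₀)ẋ₀ +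
> B(r₀)` and `B₁^± = x̄₁ + B(r₁^±)` each enclose a unique zero of `f(ν₁, ·)`; proof: "Since the balls are
> nested, these zeros are one and the same".]

RENDERING (the Banach-space vocabulary of `RadiiPolynomial.lean`, where the negativity of the printed
radii polynomials is the pair of bounds `‖A f(ν, x_ν)‖ ≤ Y₀`, `‖I − A∘D_x f(ν, x)‖ ≤ Z` on `B̄_r(x_ν)` with
`Y₀ + Z r < r`, cf. the docstring of `existsUnique_zero_of_newtonLike`).  `Λ` a topological space of
parameters and `S ⊆ Λ` the parameter patch (the paper: an interval), `F : Λ → X → Y` (`X` real Banach,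
`Y` real normed), derivative `F' ν x` in `x` on the tube, predictor `xbar : Λ → X` (the paper's
`x_ν = x̄ + Δ_ν ẋ`; any centre curve continuous on `S`), ONE injective `A : Y →L X` for the patch (as
printed).  The regularity conclusion is rendered at `ℓ = 0` — CONTINUITY of the branch on `S`, from
joint continuity of `f` and continuity of the predictor, by the uniform contraction principle made
quantitative (an explicit modulus, see the proof); the `C^ℓ` clause (implicit function theorem along the
branch) is not rendered.  The uniqueness-in-the-tube clause — the content of the words "no fold / no second
branch inside the tube" in a validated-continuation certificate — is rendered in full.

## Contents (all proved; no named facts, no definitions)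
* `norm_zero_sub_le_of_newtonLike` — a-posteriori bound inside a validated ball: a zero `x⋆` and ANY point
  `x̃` of `B̄_r(x̄)` satisfy `‖x⋆ − x̃‖ ≤ ‖A F(x̃)‖/(1 − Z)` (Krawczyk's enclosure `x⋆ ∈ K(x, x̃)`,
  [Neumaier1991] Thm. 5.1.8 (i), taken at the point `x̃` and rearranged; the estimate that drives the
  uniform contraction principle).
* `exists_continuousOn_branch_of_newtonLike` — Lemma 7 at `ℓ = 0`: a branch `g : S → B̄_r(x_ν)` of zeros,
  the ONLY zeros in the tube (so the zero set of `f` inside the tube is exactly the graph of `g` over `S`: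
  no fold, no second branch), continuous on `S` (explicit modulus in the proof:
  `‖g ν − g μ‖ ≤ ‖A f(ν, x_ν + (g μ − x_μ))‖/(1 − Z) + ‖x_ν − x_μ‖`).
* `zero_eq_of_closedBall_subset` — Proposition 8 (junction): nested enclosures at the common parameter
  value carry the same zero; `exists_continuousOn_branch_union_Icc` — two continuous branches on
  `[ν₀, ν₁]` and `[ν₁, ν₂]` that agree at `ν₁` glue to one continuous branch on `[ν₀, ν₂]`.

USE (cell ns-blowup profile zones, e.g. an `α`- or `ν`-continuation of a MODEL profile): a certificate
lists patches `(S_k, x̄_k, ẋ_k, A_k, Y₀ᵏ, Zᵏ, r_k)` with the two uniform bounds and, at every junction,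
the kernel-checkable nesting inequality `‖centre₀ − centre₁‖ + r₀ ≤ r₁⁺` (`Metric.closedBall_subset_closedBall'`);
these theorems turn that table into "a continuous branch, unique in the union of the tubes, no fold".
What such a row does NOT kernel-check is unchanged: that the programs' intervals bound the analytic
quantities uniformly on each patch.

RELATED IN THE TREE (finite-dimensional interval-box setting): the parameter-dependent Krawczyk test of
[Neumaier1991] Thm. 5.5.1 / Prop. 5.5.2 — existence, uniqueness AND continuity of `t ↦ H(t)` on a parameter
set from ONE box test — is PROVED in `Literature/Analysis/ValidatedNumerics/ParameterDependentSystems.lean`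
(`exists_continuousOn_solution`, `existsUnique_zero`, `exists_continuousOn_solution_scaled`) for
`G : ℝⁿ × P → ℝⁿ` with slope sets; the present file is the Banach-space / radii-polynomial rendering
(arbitrary real Banach `X`, derivative bounds on balls, predictor curve) of the corresponding statements of
[BergLessardMischaikow2010], plus the junction step.

## References
* [BergLessardMischaikow2010] Math. Comp. 79 (2010) 1565–1584, doi:10.1090/S0025-5718-10-02325-2,
  §2: Lemma 5, Lemma 7, Proposition 8.
* [Neumaier1991] A. Neumaier, Interval Methods for Systems of Equations, CUP, Thm. 5.1.8 (i).
* [HungriaLessardMirelesJames2016] Math. Comp. 85 (2016) 1427–1459, §3 Prop. 1 (the pointwise theorem).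
-/

noncomputable section

open Metric Set Filter
open scoped Topology

namespace Literature.Analysis.Calculus

variable {X Y : Type*} [NormedAddCommGroup X] [NormedSpace ℝ X]
  [NormedAddCommGroup Y] [NormedSpace ℝ Y]

/-- **A-posteriori bound inside a validated ball** (Krawczyk's enclosure [Neumaier1991] Thm. 5.1.8 (i)
taken at an arbitrary point `x̃` of the box: "every zero `x* ∈ x` of `F` satisfies `x* ∈ K(x, x̃)`",
`K(x, x̃) = x̃ − C F(x̃) − (C A − I)(x − x̃)`, rearranged).  If `F` has derivative `F'` on `B̄_r(x̄)` and
`‖I − A∘F'(x)‖ ≤ Z < 1` there, then a zero `x⋆ ∈ B̄_r(x̄)` and ANY `x̃ ∈ B̄_r(x̄)` satisfy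
`‖x⋆ − x̃‖ ≤ ‖A F(x̃)‖ / (1 − Z)`.  (Proof: `T x⋆ = x⋆`, `‖T x⋆ − T x̃‖ ≤ Z‖x⋆ − x̃‖` by the mean value
inequality on the convex ball, and `x̃ − T x̃ = A F(x̃)`.)  No completeness, no injectivity needed.
[cite: Neumaier1991, Thm. 5.1.8 (i) (§5.1)] -/
theorem norm_zero_sub_le_of_newtonLike {F : X → Y} {F' : X → X →L[ℝ] Y} {xbar : X}
    {A : Y →L[ℝ] X} {Z r : ℝ}
    (hF : ∀ x ∈ closedBall xbar r, HasFDerivAt F (F' x) x)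
    (hZ : ∀ x ∈ closedBall xbar r, ‖ContinuousLinearMap.id ℝ X - A.comp (F' x)‖ ≤ Z) (hZ1 : Z < 1)
    {xs : X} (hxs : xs ∈ closedBall xbar r) (hFxs : F xs = 0)
    {xt : X} (hxt : xt ∈ closedBall xbar r) :
    ‖xs - xt‖ ≤ ‖A (F xt)‖ / (1 - Z) := by
  have hT : newtonLikeMap A F xs = xs := by
    rw [newtonLikeMap_apply, hFxs, map_zero, sub_zero]
  have hlip : ‖newtonLikeMap A F xs - newtonLikeMap A F xt‖ ≤ Z * ‖xs - xt‖ :=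
    (convex_closedBall xbar r).norm_image_sub_le_of_norm_hasFDerivWithin_le
      (fun z hz => (hasFDerivAt_newtonLikeMap (hF z hz)).hasFDerivWithinAt) hZ hxt hxs
  rw [hT] at hlip
  have hid : xs - xt = (xs - newtonLikeMap A F xt) + (-(A (F xt))) := by
    rw [newtonLikeMap_apply]
    abel
  have hle : ‖xs - xt‖ ≤ Z * ‖xs - xt‖ + ‖A (F xt)‖ := by
    calc ‖xs - xt‖ = ‖(xs - newtonLikeMap A F xt) + (-(A (F xt)))‖ := by rw [← hid]
      _ ≤ ‖xs - newtonLikeMap A F xt‖ + ‖-(A (F xt))‖ := norm_add_le _ _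
      _ ≤ Z * ‖xs - xt‖ + ‖A (F xt)‖ := by rw [norm_neg]; gcongr
  rw [le_div_iff₀ (by linarith)]
  nlinarith [norm_nonneg (xs - xt)]

section Branch

variable [CompleteSpace X] {Λ : Type*} [TopologicalSpace Λ]

/-- **Lemma 7 of [BergLessardMischaikow2010] (rigorous branch following), continuity version.**
`X` a real Banach space, `Y` a real normed space, `Λ` a topological parameter space, `S ⊆ Λ` a parameter
patch, `f : Λ → X → Y` jointly continuous on `S × X` with derivative `F' ν x` in `x` at every point of the
tube `{(ν, x) : ν ∈ S, x ∈ B̄_r(x_ν)}` around a predictor curve `x_ν = xbar ν` continuous on `S`,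
`A : Y →L X` injective, and UNIFORM bounds `‖A f(ν, x_ν)‖ ≤ Y₀`, `‖I − A∘F'(ν, x)‖ ≤ Z` on the tube, with
`Y₀ + Z r < r` (`r ≥ 0`).  Then there is `g : Λ → X` with: `g ν ∈ B̄_r(x_ν)` and `f(ν, g ν) = 0` for every
`ν ∈ S`; these are the ONLY zeros of `f` in the tube (no second branch, no fold inside the tube); and `g`
is continuous on `S`.  Proof as printed: for each `ν`, `T_ν = I − A f(ν, ·)` is a `Z`-contraction of
`B̄_r(x_ν)` (`existsUnique_zero_of_newtonLike`); continuity by the uniform contraction principle, here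
through the a-posteriori bound `norm_zero_sub_le_of_newtonLike` (explicit modulus
`‖g ν − g μ‖ ≤ ‖A f(ν, x_ν + (g μ − x_μ))‖/(1 − Z) + ‖x_ν − x_μ‖`).  The printed `C^ℓ` regularity is not
rendered.
[cite: BergLessardMischaikow2010, Lemma 7 (§2)] -/
theorem exists_continuousOn_branch_of_newtonLike {F : Λ → X → Y} {F' : Λ → X → X →L[ℝ] Y}
    {xbar : Λ → X} {A : Y →L[ℝ] X} {Y₀ Z r : ℝ} {S : Set Λ} (hr : 0 ≤ r)
    (hA : Function.Injective A)
    (hF : ∀ ν ∈ S, ∀ x ∈ closedBall (xbar ν) r, HasFDerivAt (F ν) (F' ν x) x)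
    (hFc : ContinuousOn (Function.uncurry F) (S ×ˢ univ))
    (hxbar : ContinuousOn xbar S)
    (hY : ∀ ν ∈ S, ‖A (F ν (xbar ν))‖ ≤ Y₀)
    (hZ : ∀ ν ∈ S, ∀ x ∈ closedBall (xbar ν) r, ‖ContinuousLinearMap.id ℝ X - A.comp (F' ν x)‖ ≤ Z)
    (h : Y₀ + Z * r < r) :
    ∃ g : Λ → X, (∀ ν ∈ S, g ν ∈ closedBall (xbar ν) r ∧ F ν (g ν) = 0) ∧
      (∀ ν ∈ S, ∀ y ∈ closedBall (xbar ν) r, F ν y = 0 → y = g ν) ∧ ContinuousOn g S := by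
  classical
  -- pointwise existence and uniqueness
  have hpt : ∀ ν ∈ S, ∃ x ∈ closedBall (xbar ν) r, F ν x = 0 ∧
      ∀ y ∈ closedBall (xbar ν) r, F ν y = 0 → y = x := by
    intro ν hν
    obtain ⟨x, hx, hFx, huniq, -⟩ :=
      existsUnique_zero_of_newtonLike hr hA (hF ν hν) (hY ν hν) (hZ ν hν) h
    exact ⟨x, hx, hFx, huniq⟩
  let g : Λ → X := fun ν => if hν : ν ∈ S then Classical.choose (hpt ν hν) else xbar ν
  have hg : ∀ ν ∈ S, g ν ∈ closedBall (xbar ν) r ∧ F ν (g ν) = 0 ∧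
      ∀ y ∈ closedBall (xbar ν) r, F ν y = 0 → y = g ν := by
    intro ν hν
    have hspec := Classical.choose_spec (hpt ν hν)
    simp only [g, dif_pos hν]
    exact ⟨hspec.1, hspec.2.1, hspec.2.2⟩
  refine ⟨g, fun ν hν => ⟨(hg ν hν).1, (hg ν hν).2.1⟩, fun ν hν => (hg ν hν).2.2, ?_⟩
  -- continuity on `S` from the a-posteriori bound
  intro μ hμ
  -- `Z < 1` (as in the pointwise theorem: `r > 0` since `Y₀ ≥ 0`)
  have hZ1 : Z < 1 := by
    have hY₀ : 0 ≤ Y₀ := le_trans (norm_nonneg _) (hY μ hμ)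
    have hrpos : 0 < r := by
      rcases hr.eq_or_lt with h0 | h0
      · exfalso; rw [← h0] at h; linarith
      · exact h0
    nlinarith
  -- explicit modulus: ‖g ν − g μ‖ ≤ ‖A f(ν, x_ν + (g μ − x_μ))‖/(1 − Z) + ‖x_ν − x_μ‖
  set y : X := g μ - xbar μ with hy
  have hyr : ‖y‖ ≤ r := mem_closedBall_iff_norm.1 (hg μ hμ).1
  have hmod : ∀ ν ∈ S, ‖g ν - g μ‖ ≤ ‖A (F ν (xbar ν + y))‖ / (1 - Z) + ‖xbar ν - xbar μ‖ := by
    intro ν hν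
    have hxt : xbar ν + y ∈ closedBall (xbar ν) r := by
      rw [mem_closedBall_iff_norm, add_sub_cancel_left]
      exact hyr
    have hap := norm_zero_sub_le_of_newtonLike (hF ν hν) (hZ ν hν) hZ1 (hg ν hν).1 (hg ν hν).2.1 hxt
    have hsplit : g ν - g μ = (g ν - (xbar ν + y)) + (xbar ν - xbar μ) := by
      rw [hy]; abel
    calc ‖g ν - g μ‖ = ‖(g ν - (xbar ν + y)) + (xbar ν - xbar μ)‖ := by rw [hsplit]
      _ ≤ ‖g ν - (xbar ν + y)‖ + ‖xbar ν - xbar μ‖ := norm_add_le _ _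
      _ ≤ ‖A (F ν (xbar ν + y))‖ / (1 - Z) + ‖xbar ν - xbar μ‖ := by gcongr
  -- the modulus tends to `0` as `ν → μ` within `S`
  have hxb : Tendsto xbar (𝓝[S] μ) (𝓝 (xbar μ)) := hxbar μ hμ
  have hpath : ContinuousWithinAt (fun ν => (ν, xbar ν + y)) S μ :=
    continuousWithinAt_id.prodMk ((hxbar μ hμ).add continuousWithinAt_const)
  have hF0 : ContinuousWithinAt (Function.uncurry F) (S ×ˢ univ) (μ, xbar μ + y) :=
    hFc _ ⟨hμ, mem_univ _⟩
  have hcomp : ContinuousWithinAt ((Function.uncurry F) ∘ (fun ν => (ν, xbar ν + y))) S μ :=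
    ContinuousWithinAt.comp (f := fun ν => (ν, xbar ν + y)) hF0 hpath
      (fun ν hν => ⟨hν, mem_univ _⟩)
  have hval : F μ (xbar μ + y) = 0 := by
    rw [hy, add_sub_cancel]
    exact (hg μ hμ).2.1
  have hT1 : Tendsto (fun ν => ‖A (F ν (xbar ν + y))‖ / (1 - Z)) (𝓝[S] μ) (𝓝 0) := by
    have h1 : Tendsto (fun ν => A (F ν (xbar ν + y))) (𝓝[S] μ) (𝓝 (A (F μ (xbar μ + y)))) :=
      (A.continuous.tendsto _).comp hcomp.tendsto
    rw [hval, map_zero] at h1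
    have h2 := h1.norm
    rw [norm_zero] at h2
    simpa using h2.div_const (1 - Z)
  have hT2 : Tendsto (fun ν => ‖xbar ν - xbar μ‖) (𝓝[S] μ) (𝓝 0) :=
    tendsto_iff_norm_sub_tendsto_zero.1 hxb
  have hT : Tendsto (fun ν => ‖A (F ν (xbar ν + y))‖ / (1 - Z) + ‖xbar ν - xbar μ‖)
      (𝓝[S] μ) (𝓝 0) := by
    simpa using hT1.add hT2
  have hev : ∀ᶠ ν in 𝓝[S] μ, ‖g ν - g μ‖ ≤ ‖A (F ν (xbar ν + y))‖ / (1 - Z) + ‖xbar ν - xbar μ‖ :=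
    eventually_nhdsWithin_of_forall hmod
  have hlim : Tendsto (fun ν => g ν - g μ) (𝓝[S] μ) (𝓝 0) := squeeze_zero_norm' hev hT
  exact tendsto_sub_nhds_zero_iff.1 hlim

end Branch

omit [NormedSpace ℝ X] [NormedSpace ℝ Y] in
/-- **Proposition 8 of [BergLessardMischaikow2010] (junction of two validated patches), the nesting
argument.**  At a common parameter value let `B₀ = B̄_{r₀}(c₀)` contain a zero `z₀` of `f` and let
`B₁ = B̄_{r₁}(c₁)` contain EXACTLY one zero `z₁`.  If `B₀ ⊆ B₁` ("the balls are nested") then `z₀ = z₁`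
("these zeros are one and the same") — so the two branches meet and `C₀ ∪ C₁` is one continuous branch
(`exists_continuousOn_branch_union_Icc`).  The nesting is checked in practice as
`dist c₀ c₁ + r₀ ≤ r₁` (`Metric.closedBall_subset_closedBall'`).
[cite: BergLessardMischaikow2010, Prop. 8 (§2)] -/
theorem zero_eq_of_closedBall_subset {f : X → Y} {c₀ c₁ z₀ z₁ : X} {r₀ r₁ : ℝ}
    (hsub : closedBall c₀ r₀ ⊆ closedBall c₁ r₁)
    (hz₀ : z₀ ∈ closedBall c₀ r₀) (hf₀ : f z₀ = 0)
    (huniq : ∀ y ∈ closedBall c₁ r₁, f y = 0 → y = z₁) : z₀ = z₁ :=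
  huniq z₀ (hsub hz₀) hf₀

omit [NormedSpace ℝ X] [NormedSpace ℝ Y] in
/-- **Proposition 8 of [BergLessardMischaikow2010], the gluing conclusion** ("`C₀ ∪ C₁` consists of a
continuous branch of solutions of `f(ν, x) = 0`"): two branches of zeros `g₀` on `[ν₀, ν₁]` and `g₁` on
`[ν₁, ν₂]`, each continuous on its interval, which take the same value at `ν₁` (the conclusion of
`zero_eq_of_closedBall_subset`), glue to ONE branch `g` continuous on `[ν₀, ν₂]`, equal to `g₀` on
`[ν₀, ν₁]` and to `g₁` on `[ν₁, ν₂]`.  (Pasting of continuous maps on two closed pieces.)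
[cite: BergLessardMischaikow2010, Prop. 8 (§2)] -/
theorem exists_continuousOn_branch_union_Icc {F : ℝ → X → Y} {g₀ g₁ : ℝ → X} {ν₀ ν₁ ν₂ : ℝ}
    (h₀₁ : ν₀ ≤ ν₁) (h₁₂ : ν₁ ≤ ν₂)
    (hg₀ : ContinuousOn g₀ (Icc ν₀ ν₁)) (hg₁ : ContinuousOn g₁ (Icc ν₁ ν₂))
    (hz₀ : ∀ ν ∈ Icc ν₀ ν₁, F ν (g₀ ν) = 0) (hz₁ : ∀ ν ∈ Icc ν₁ ν₂, F ν (g₁ ν) = 0)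
    (hjoin : g₀ ν₁ = g₁ ν₁) :
    ∃ g : ℝ → X, ContinuousOn g (Icc ν₀ ν₂) ∧ (∀ ν ∈ Icc ν₀ ν₂, F ν (g ν) = 0) ∧
      EqOn g g₀ (Icc ν₀ ν₁) ∧ EqOn g g₁ (Icc ν₁ ν₂) := by
  classical
  let g : ℝ → X := fun ν => if ν ≤ ν₁ then g₀ ν else g₁ ν
  have hE₀ : EqOn g g₀ (Icc ν₀ ν₁) := fun ν hν => by simp [g, hν.2]
  have hE₁ : EqOn g g₁ (Icc ν₁ ν₂) := by
    intro ν hν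
    by_cases hle : ν ≤ ν₁
    · have hEq : ν = ν₁ := le_antisymm hle hν.1
      simp [g, hEq, hjoin]
    · simp [g, hle]
  have hc₀ : ContinuousOn g (Icc ν₀ ν₁) := hg₀.congr hE₀
  have hc₁ : ContinuousOn g (Icc ν₁ ν₂) := hg₁.congr hE₁
  have hc : ContinuousOn g (Icc ν₀ ν₁ ∪ Icc ν₁ ν₂) :=
    hc₀.union_of_isClosed hc₁ isClosed_Icc isClosed_Icc
  rw [Icc_union_Icc_eq_Icc h₀₁ h₁₂] at hc
  refine ⟨g, hc, fun ν hν => ?_, hE₀, hE₁⟩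
  rcases Icc_subset_Icc_union_Icc (b := ν₁) hν with h | h
  · rw [hE₀ h]; exact hz₀ ν h
  · rw [hE₁ h]; exact hz₁ ν h

end Literature.Analysis.Calculus

end
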